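/-
Copyright (c) 2026 the pub-hodgecm-mathlib formalisation cell (harness21).  Prover seat hodgecm-mathlib-K2E3-p27 (g0), HCML Track B «K2-LIT» ∕ h413
(`stmt-HodgeConjecture-24833`), line `K2_E3_EllipticInputs`, unit U12 «Characters», PART «RANK» leaf (11-2qs-Id′) ∕ (qs2-ps) «van Dijk₂», deal D117 (HCD₂)
(dealer K2E3-plan (g4)), FILE 4 OF 4 «HCD₂-HEAD»: `|D_{U(1,1)}|^{−1∕2} ∈ L¹_loc` on the organ's quasi-split carrier `G₂ = U(Φ₂)(L⁺_v)`, in ★ D115 `dgFormula₂` currency —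
THE (HCD₂) BRICK HEAD (the `2 × 2` twin of ★ `F0P3cStCharTSWeylDiscrLocInt`).  2026-09-04.
-/
import Summits.HodgeConjecture.HodgeConjecture.Theorems.K2E3U11WeylDiscrModel          -- FILE 3 (this seat): `hcd₂_model` (the one-place model); brings FILES 1, 2a, 2b, ★ `localNonsplitEquiv`
import Summits.HodgeConjecture.HodgeConjecture.Theorems.K2E3QuasiSplitTwoTorusDefs       -- ★ D115 p860691 (K2E3-p26 g0): `dgFormula₂`, `dgFormula₂_def` (rfl)
import Summits.HodgeConjecture.HodgeConjecture.Theorems.F0P3cStCharTSHCDLocIntTransport  -- ★ p852046 (F0P2-p01): `locallyIntegrable_of_forall_exists_setLIntegral_lt_top`, `enorm_inv_coe_le_inv_coe`, `forall_exists_setLIntegral_comp_lt_top_of_map_mulEquiv`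
import Literature.LinearAlgebra.Matrix.CharpolyDiscTwinBridge                               -- ★ `matrix_discr_map` (`disc` commutes with ring maps)
import HarnessLib

/-!
# Deal D117 (HCD₂), FILE 4 «HCD₂-HEAD»: `(dg₂)⁻¹ = |D_{U(1,1)}|^{−1∕2}` is LOCALLY INTEGRABLE on `U(Φ₂)(L⁺_v)` for every Haar measure (Harish-Chandra 1970 Part VII §1 Thm. 15,
# rank one, in-house) — the brick (HCD₂) of the (qs2-ps) «van Dijk₂» road

Cell `pub/hodgecm-mathlib` (D-0151), Track B «K2-LIT», crux H413 = `stmt-HodgeConjecture-24833`, route `HCCMUnconditional`.  Lane `--supports stmt-HodgeConjecture-24833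
--as helper`; THEOREMS ONLY (no `def`, no `instance`, no `notation`, no named-fact hypothesis, no `sorry`); count-neutral.  Consumer: (ASM₂) `K2E3CharLocIntNearPrincipalSeriesQuasiSplitTwo`
(K2E3-p21 (g8)), whose `hHCD` antecedent is `locallyIntegrable_dgFormula₂_inv` below (bytes posted on the K2 bus 2026-09-04T13:44Z).

WHAT.  `G₂ := ↥(unitaryGroupOfForm (conjLocal L c v) (cmLocalForm L 2 v)) = U(Φ₂)(L⁺_v)` (the organ's carrier; ★ `cmPrincipalSeries L 2 v`, ★ D115), `v` NON-SPLIT, `ν` any Haar measure.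
`dg₂(g) = ⁴√(N(disc χ_g)·N(det g)⁻¹)`, `N(x) = Π_{w∣v} ‖x_w‖_w` (★ `dgFormula₂`).  HEADS **`locallyIntegrable_weylDiscr_inv_two`** (raw token) and **`locallyIntegrable_dgFormula₂_inv`**:
`LocallyIntegrable (fun g => (dg₂ g)⁻¹) ν`.  PROOF (the ★ D7 pattern at `Fin 2`): along `e := localNonsplitEquiv : G₂ ≃ₜ* U(σ_w, Φ₂)(L_w)` the token reads `(√√(‖disc χ_{g_w}‖_w·‖det g_w‖_w⁻¹))⁻¹`
(§1: entries at the unique `w ∣ v` — `rfl` on ★ `localNonsplitEquiv` —, `disc`∕`det` commute with evaluation, products over the singleton `PlacesOver L v`); ★ FILE 3 `hcd₂_model` gives finite `∫⁻` near every point for the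
Haar measure `ν.map e`; ★ `…HCDLocIntTransport` pulls the neighbourhood bounds back and converts to `LocallyIntegrable` (the real integrand is measurable and dominated by the token).

* §1 `token_localNonsplitEquiv_two_eq` (★ `matrix_discr_map`, `RingHom.map_det`); §2 `measurable_weylDiscr_inv_two`, `locallyIntegrable_weylDiscr_inv_two_of_model`;
  §3 HEADS `locallyIntegrable_weylDiscr_inv_two`, `locallyIntegrable_dgFormula₂_inv`.

HONEST LABEL: HC_CM is proved only modulo the 7 printed citations (2 remaining named inputs: hLiu418 = stmt-HodgeConjecture-24832, h413 = stmt-HodgeConjecture-24833) until rung 0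
closes; count-neutral helper; (HCD₂) is ONE of the five bricks of (qs2-ps) — it closes no socket by itself.

## References
* [HarishChandra1970] Harish-Chandra, *Harmonic analysis on reductive p-adic groups*, LNM 162 (1970), Part VII §1 Thm. 15.
* [Rogawski1990] J. D. Rogawski, *Automorphic Representations of Unitary Groups in Three Variables* (1990), §4.9 p. 54 (`D_G`), §12.5 p. 182.
* [PlatonovRapinchuk1994] V. Platonov, A. Rapinchuk, *Algebraic Groups and Number Theory* (1994), §5.1.
-/

set_option autoImplicit false
set_option linter.dupNamespace false

noncomputable section

open MeasureTheory Filter Topology Polynomial Set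
open NumberField IsDedekindDomain
open scoped NNReal ENNReal Matrix MatrixGroups
open Literature.NumberTheory.Automorphic Literature.NumberTheory.Automorphic.UnitaryGroup Literature.NumberTheory.Automorphic.LocalFieldHaar
open Literature.NumberTheory.GaloisRepresentations Literature.NumberTheory.GaloisRepresentations.IsNonarchimedeanLocalField
open Summit.HodgeConjecture.HodgeConjecture.Cruxes.H413.F0P3cStCharTSHCDLocIntTransport
open Summit.HodgeConjecture.HodgeConjecture.Cruxes.H413.K2E3U11WeylDiscrModel (hcd₂_model)
open Summit.HodgeConjecture.HodgeConjecture.Cruxes.H413.K2E3QuasiSplitTwoTorusDefs (dgFormula₂ dgFormula₂_def)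

namespace Summit.HodgeConjecture.HodgeConjecture.Cruxes.H413.K2E3U11WeylDiscrLocInt

/-! ## §1 The `w`-component identity at a non-split place -/

section CM

variable (L : Type) [Field L] [NumberField L] [IsCMField L] (v : HeightOneSpectrum (𝓞 ↥(maximalRealSubfield L)))
  (w : PlacesOver L v) (hw : IsCMField.complexConj L • w.1 = w.1)

/-- **Group-side token = organ token along `e = localNonsplitEquiv`** (`N = 2`, `det`-exponent `1`): for `g ∈ U(Φ₂)(L⁺_v)` (`v` non-split, `w ∣ v`), the `θ₂`-token of FILE 2 at
`e g` (entries read at `w`, `rfl` on ★ `localNonsplitEquiv`) equals the `ℝ≥0∞`-token of `(dg₂ g)⁻¹` (products over the singleton `PlacesOver L v`). [cite: PlatonovRapinchuk1994, §5.1] -/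
theorem token_localNonsplitEquiv_two_eq (g : ↥(unitaryGroupOfForm (conjLocal L (IsCMField.complexConj L) v) (cmLocalForm L 2 v))) :
    ((NNReal.sqrt (NNReal.sqrt (normAbs (w.1.adicCompletion L)
        ((((((localNonsplitEquiv (IsCMField.complexConj L) (Matrix.of fun i j : Fin 2 => if i.val + j.val + 1 = 2 then (1 : L) else 0) (IsCMField.complexConj_ne_one L) w hw) g :
            ↥(unitaryGroupOfForm (galAdicCompletionMap (L := L) (IsCMField.complexConj L) hw)
              (placeForm (Matrix.of fun i j : Fin 2 => if i.val + j.val + 1 = 2 then (1 : L) else 0) w.1))) :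
            GL (Fin 2) (w.1.adicCompletion L)) : Matrix (Fin 2) (Fin 2) (w.1.adicCompletion L))).charpoly.discr) *
      (normAbs (w.1.adicCompletion L)
        ((((((localNonsplitEquiv (IsCMField.complexConj L) (Matrix.of fun i j : Fin 2 => if i.val + j.val + 1 = 2 then (1 : L) else 0) (IsCMField.complexConj_ne_one L) w hw) g :
            ↥(unitaryGroupOfForm (galAdicCompletionMap (L := L) (IsCMField.complexConj L) hw)
              (placeForm (Matrix.of fun i j : Fin 2 => if i.val + j.val + 1 = 2 then (1 : L) else 0) w.1))) :
            GL (Fin 2) (w.1.adicCompletion L)) : Matrix (Fin 2) (Fin 2) (w.1.adicCompletion L))).det))⁻¹)) : ℝ≥0∞))⁻¹ =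
    ((NNReal.sqrt (NNReal.sqrt ((∏ w' : PlacesOver L v, normAbs (w'.1.adicCompletion L) ((((g.val : GL (Fin 2) (UnitaryGroup.LocalRing L v)).val).charpoly.discr) w')) *
      (∏ w' : PlacesOver L v, normAbs (w'.1.adicCompletion L) ((((g.val : GL (Fin 2) (UnitaryGroup.LocalRing L v)).val).det) w'))⁻¹)) : ℝ≥0∞))⁻¹ := by
  haveI : Subsingleton (PlacesOver L v) := PlacesOver.subsingleton_of_smul_eq (IsCMField.complexConj L) (IsCMField.complexConj_ne_one L) w hw
  have hmat : ((((localNonsplitEquiv (IsCMField.complexConj L) (Matrix.of fun i j : Fin 2 => if i.val + j.val + 1 = 2 then (1 : L) else 0) (IsCMField.complexConj_ne_one L) w hw) g :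
          ↥(unitaryGroupOfForm (galAdicCompletionMap (L := L) (IsCMField.complexConj L) hw)
            (placeForm (Matrix.of fun i j : Fin 2 => if i.val + j.val + 1 = 2 then (1 : L) else 0) w.1))) :
          GL (Fin 2) (w.1.adicCompletion L)) : Matrix (Fin 2) (Fin 2) (w.1.adicCompletion L)) =
      (((g.val : GL (Fin 2) (UnitaryGroup.LocalRing L v)).val : Matrix (Fin 2) (Fin 2) (UnitaryGroup.LocalRing L v))).map
        (Pi.evalRingHom (fun w' : PlacesOver L v => w'.1.adicCompletion L) w) := rfl
  have hdisc : ((((localNonsplitEquiv (IsCMField.complexConj L) (Matrix.of fun i j : Fin 2 => if i.val + j.val + 1 = 2 then (1 : L) else 0) (IsCMField.complexConj_ne_one L) w hw) g :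
          ↥(unitaryGroupOfForm (galAdicCompletionMap (L := L) (IsCMField.complexConj L) hw)
            (placeForm (Matrix.of fun i j : Fin 2 => if i.val + j.val + 1 = 2 then (1 : L) else 0) w.1))) :
          GL (Fin 2) (w.1.adicCompletion L)) : Matrix (Fin 2) (Fin 2) (w.1.adicCompletion L)).charpoly.discr =
      ((g.val : GL (Fin 2) (UnitaryGroup.LocalRing L v)).val.charpoly.discr) w := by
    rw [hmat, ← Matrix.discr, Literature.LinearAlgebra.Matrix.matrix_discr_map, Matrix.discr]
    rfl
  have hdet : ((((localNonsplitEquiv (IsCMField.complexConj L) (Matrix.of fun i j : Fin 2 => if i.val + j.val + 1 = 2 then (1 : L) else 0) (IsCMField.complexConj_ne_one L) w hw) g :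
          ↥(unitaryGroupOfForm (galAdicCompletionMap (L := L) (IsCMField.complexConj L) hw)
            (placeForm (Matrix.of fun i j : Fin 2 => if i.val + j.val + 1 = 2 then (1 : L) else 0) w.1))) :
          GL (Fin 2) (w.1.adicCompletion L)) : Matrix (Fin 2) (Fin 2) (w.1.adicCompletion L)).det =
      ((g.val : GL (Fin 2) (UnitaryGroup.LocalRing L v)).val.det) w := by
    rw [hmat, ← RingHom.mapMatrix_apply, ← RingHom.map_det]
    rfl
  rw [Fintype.prod_subsingleton _ w, Fintype.prod_subsingleton _ w, hdisc, hdet]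

end CM

/-! ## §2 Measurability of the real integrand; the head from the model statement -/

section Head

variable (L : Type) [Field L] [NumberField L] [IsCMField L] (v : HeightOneSpectrum (𝓞 ↥(maximalRealSubfield L)))

/-- **The real integrand `(dg₂)⁻¹` is measurable** on `U(Φ₂)(L⁺_v)` (entries, `disc = tr² − 4det` and `det` are continuous; `|·|_w` is continuous ★ `continuous_normAbs`; `ℝ≥0`-inverse,
square roots and the real inverse are measurable). [cite: Rogawski1990, §4.9 p. 54] -/
theorem measurable_weylDiscr_inv_two
    [MeasurableSpace ↥(unitaryGroupOfForm (conjLocal L (IsCMField.complexConj L) v) (cmLocalForm L 2 v))]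
    [BorelSpace ↥(unitaryGroupOfForm (conjLocal L (IsCMField.complexConj L) v) (cmLocalForm L 2 v))] :
    Measurable fun g : ↥(unitaryGroupOfForm (conjLocal L (IsCMField.complexConj L) v) (cmLocalForm L 2 v)) =>
      (((NNReal.sqrt (NNReal.sqrt ((∏ w : PlacesOver L v, normAbs (w.1.adicCompletion L) (((g.val : GL (Fin 2) (UnitaryGroup.LocalRing L v)).val.charpoly.discr) w)) *
        (∏ w : PlacesOver L v, normAbs (w.1.adicCompletion L) (((g.val : GL (Fin 2) (UnitaryGroup.LocalRing L v)).val.det) w))⁻¹)) : ℝ≥0) : ℝ))⁻¹ := by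
  have hM : Continuous fun g : ↥(unitaryGroupOfForm (conjLocal L (IsCMField.complexConj L) v) (cmLocalForm L 2 v)) =>
      ((g.val : GL (Fin 2) (UnitaryGroup.LocalRing L v)).val : Matrix (Fin 2) (Fin 2) (UnitaryGroup.LocalRing L v)) :=
    Units.continuous_val.comp continuous_subtype_val
  have hdisc : Continuous fun g : ↥(unitaryGroupOfForm (conjLocal L (IsCMField.complexConj L) v) (cmLocalForm L 2 v)) =>
      ((g.val : GL (Fin 2) (UnitaryGroup.LocalRing L v)).val).charpoly.discr := by
    have heq : (fun g : ↥(unitaryGroupOfForm (conjLocal L (IsCMField.complexConj L) v) (cmLocalForm L 2 v)) =>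
        ((g.val : GL (Fin 2) (UnitaryGroup.LocalRing L v)).val).charpoly.discr) =
        fun g => ((g.val : GL (Fin 2) (UnitaryGroup.LocalRing L v)).val).trace ^ 2 - 4 * ((g.val : GL (Fin 2) (UnitaryGroup.LocalRing L v)).val).det := by
      funext g
      rw [← Matrix.discr, Matrix.discr_fin_two]
    rw [heq]
    exact ((hM.matrix_trace).pow 2).sub (continuous_const.mul hM.matrix_det)
  have hdet : Continuous fun g : ↥(unitaryGroupOfForm (conjLocal L (IsCMField.complexConj L) v) (cmLocalForm L 2 v)) =>
      ((g.val : GL (Fin 2) (UnitaryGroup.LocalRing L v)).val).det := hM.matrix_det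
  have h1 : Continuous fun g : ↥(unitaryGroupOfForm (conjLocal L (IsCMField.complexConj L) v) (cmLocalForm L 2 v)) =>
      ∏ w : PlacesOver L v, normAbs (w.1.adicCompletion L) (((g.val : GL (Fin 2) (UnitaryGroup.LocalRing L v)).val.charpoly.discr) w) :=
    continuous_finsetProd _ fun w _ => continuous_normAbs.comp ((continuous_apply w).comp hdisc)
  have h2 : Continuous fun g : ↥(unitaryGroupOfForm (conjLocal L (IsCMField.complexConj L) v) (cmLocalForm L 2 v)) =>
      ∏ w : PlacesOver L v, normAbs (w.1.adicCompletion L) (((g.val : GL (Fin 2) (UnitaryGroup.LocalRing L v)).val.det) w) :=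
    continuous_finsetProd _ fun w _ => continuous_normAbs.comp ((continuous_apply w).comp hdet)
  have h3 : Measurable fun g : ↥(unitaryGroupOfForm (conjLocal L (IsCMField.complexConj L) v) (cmLocalForm L 2 v)) =>
      NNReal.sqrt (NNReal.sqrt ((∏ w : PlacesOver L v, normAbs (w.1.adicCompletion L) (((g.val : GL (Fin 2) (UnitaryGroup.LocalRing L v)).val.charpoly.discr) w)) *
        (∏ w : PlacesOver L v, normAbs (w.1.adicCompletion L) (((g.val : GL (Fin 2) (UnitaryGroup.LocalRing L v)).val.det) w))⁻¹)) :=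
    (NNReal.continuous_sqrt.comp NNReal.continuous_sqrt).measurable.comp (h1.measurable.mul h2.measurable.inv)
  exact (NNReal.continuous_coe.measurable.comp h3).inv

set_option synthInstance.maxHeartbeats 400000 in
-- instance search on the organ carrier is deep (as in the ★ `3 × 3` terminal file): raise the typeclass budget for this declaration only
/-- **(HCD₂) from the MODEL STATEMENT** (the ★ D7 pattern at `N = 2`): if on the one-place model `U(σ_w, Φ₂)(L_w)` every point has a neighbourhood of finite `∫⁻` of the `θ₂`-token
against `ν.map e`, then `(dg₂)⁻¹` is locally integrable on `U(Φ₂)(L⁺_v)` for `ν`. [cite: HarishChandra1970, Part VII §1 Thm. 15] [cite: PlatonovRapinchuk1994, §5.1] -/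
theorem locallyIntegrable_weylDiscr_inv_two_of_model (w : PlacesOver L v) (hw : IsCMField.complexConj L • w.1 = w.1)
    [MeasurableSpace ↥(unitaryGroupOfForm (conjLocal L (IsCMField.complexConj L) v) (cmLocalForm L 2 v))]
    [BorelSpace ↥(unitaryGroupOfForm (conjLocal L (IsCMField.complexConj L) v) (cmLocalForm L 2 v))]
    (ν : Measure ↥(unitaryGroupOfForm (conjLocal L (IsCMField.complexConj L) v) (cmLocalForm L 2 v)))
    [MeasurableSpace ↥(unitaryGroupOfForm (galAdicCompletionMap (L := L) (IsCMField.complexConj L) hw)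
      (placeForm (Matrix.of fun i j : Fin 2 => if i.val + j.val + 1 = 2 then (1 : L) else 0) w.1))]
    [BorelSpace ↥(unitaryGroupOfForm (galAdicCompletionMap (L := L) (IsCMField.complexConj L) hw)
      (placeForm (Matrix.of fun i j : Fin 2 => if i.val + j.val + 1 = 2 then (1 : L) else 0) w.1))]
    (hModel : ∀ g₀ : ↥(unitaryGroupOfForm (galAdicCompletionMap (L := L) (IsCMField.complexConj L) hw)
        (placeForm (Matrix.of fun i j : Fin 2 => if i.val + j.val + 1 = 2 then (1 : L) else 0) w.1)),
      ∃ U ∈ 𝓝 g₀, ∫⁻ g in U,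
        ((NNReal.sqrt (NNReal.sqrt (normAbs (w.1.adicCompletion L)
            (((g : ↥(unitaryGroupOfForm (galAdicCompletionMap (L := L) (IsCMField.complexConj L) hw)
                (placeForm (Matrix.of fun i j : Fin 2 => if i.val + j.val + 1 = 2 then (1 : L) else 0) w.1))) :
                GL (Fin 2) (w.1.adicCompletion L)) : Matrix (Fin 2) (Fin 2) (w.1.adicCompletion L)).charpoly.discr *
          (normAbs (w.1.adicCompletion L)
            (((g : ↥(unitaryGroupOfForm (galAdicCompletionMap (L := L) (IsCMField.complexConj L) hw)
                (placeForm (Matrix.of fun i j : Fin 2 => if i.val + j.val + 1 = 2 then (1 : L) else 0) w.1))) :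
                GL (Fin 2) (w.1.adicCompletion L)) : Matrix (Fin 2) (Fin 2) (w.1.adicCompletion L)).det)⁻¹)) : ℝ≥0) : ℝ≥0∞)⁻¹
        ∂(ν.map (fun g : ↥(unitaryGroupOfForm (conjLocal L (IsCMField.complexConj L) v) (cmLocalForm L 2 v)) =>
          ((localNonsplitEquiv (IsCMField.complexConj L) (Matrix.of fun i j : Fin 2 => if i.val + j.val + 1 = 2 then (1 : L) else 0) (IsCMField.complexConj_ne_one L) w hw) g :
            ↥(unitaryGroupOfForm (galAdicCompletionMap (L := L) (IsCMField.complexConj L) hw)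
              (placeForm (Matrix.of fun i j : Fin 2 => if i.val + j.val + 1 = 2 then (1 : L) else 0) w.1))))) < ∞) :
    LocallyIntegrable (fun g : ↥(unitaryGroupOfForm (conjLocal L (IsCMField.complexConj L) v) (cmLocalForm L 2 v)) =>
      (((NNReal.sqrt (NNReal.sqrt ((∏ w : PlacesOver L v, normAbs (w.1.adicCompletion L) (((g.val : GL (Fin 2) (UnitaryGroup.LocalRing L v)).val.charpoly.discr) w)) *
        (∏ w : PlacesOver L v, normAbs (w.1.adicCompletion L) (((g.val : GL (Fin 2) (UnitaryGroup.LocalRing L v)).val.det) w))⁻¹)) : ℝ≥0) : ℝ))⁻¹) ν := by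
  let e' : ↥(unitaryGroupOfForm (conjLocal L (IsCMField.complexConj L) v) (cmLocalForm L 2 v)) ≃ₜ*
      ↥(unitaryGroupOfForm (galAdicCompletionMap (L := L) (IsCMField.complexConj L) hw)
        (placeForm (Matrix.of fun i j : Fin 2 => if i.val + j.val + 1 = 2 then (1 : L) else 0) w.1)) :=
    localNonsplitEquiv (IsCMField.complexConj L) (Matrix.of fun i j : Fin 2 => if i.val + j.val + 1 = 2 then (1 : L) else 0) (IsCMField.complexConj_ne_one L) w hw
  have hT := forall_exists_setLIntegral_comp_lt_top_of_map_mulEquiv e' ν _ hModel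
  refine locallyIntegrable_of_forall_exists_setLIntegral_lt_top (measurable_weylDiscr_inv_two L v).aestronglyMeasurable
    (fun g : ↥(unitaryGroupOfForm (conjLocal L (IsCMField.complexConj L) v) (cmLocalForm L 2 v)) =>
      ((NNReal.sqrt (NNReal.sqrt ((∏ w' : PlacesOver L v, normAbs (w'.1.adicCompletion L) ((((g.val : GL (Fin 2) (UnitaryGroup.LocalRing L v)).val).charpoly.discr) w')) *
        (∏ w' : PlacesOver L v, normAbs (w'.1.adicCompletion L) ((((g.val : GL (Fin 2) (UnitaryGroup.LocalRing L v)).val).det) w'))⁻¹)) : ℝ≥0∞))⁻¹) (fun g => ?_) (fun g => ?_)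
  · exact enorm_inv_coe_le_inv_coe _
  · obtain ⟨U, hU, hfin⟩ := hT g
    refine ⟨U, hU, ?_⟩
    refine lt_of_le_of_lt (le_of_eq ?_) hfin
    refine lintegral_congr fun x => ?_
    exact (token_localNonsplitEquiv_two_eq L v w hw x).symm

/-! ## §3 THE (HCD₂) HEADS -/

set_option synthInstance.maxHeartbeats 400000 in
-- instance search on the organ carrier is deep (as in the ★ `3 × 3` terminal file): raise the typeclass budget for this declaration only
/-- **(HCD₂), RAW TOKEN — `|D_{U(1,1)}|^{−1∕2} ∈ L¹_loc(U(Φ₂)(L⁺_v))`**: for `v` non-split and every Haar measure `ν` on the organ's quasi-split carrier, the function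
`g ↦ (⁴√(N(disc χ_g)·N(det g)⁻¹))⁻¹` is locally integrable — ★ FILE 3 `hcd₂_model` at `ν′ := ν.map e` (Haar by `ContinuousMulEquiv.isHaarMeasure_map`, Borel structure `borel _` on the model)
through `locallyIntegrable_weylDiscr_inv_two_of_model`. [cite: HarishChandra1970, Part VII §1 Thm. 15] [cite: Rogawski1990, §4.9 p. 54; §12.5 p. 182] [cite: PlatonovRapinchuk1994, §5.1] -/
theorem locallyIntegrable_weylDiscr_inv_two (hns : ∀ w : PlacesOver L v, IsCMField.complexConj L • w.1 = w.1)
    [MeasurableSpace ↥(unitaryGroupOfForm (conjLocal L (IsCMField.complexConj L) v) (cmLocalForm L 2 v))]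
    [BorelSpace ↥(unitaryGroupOfForm (conjLocal L (IsCMField.complexConj L) v) (cmLocalForm L 2 v))]
    (ν : Measure ↥(unitaryGroupOfForm (conjLocal L (IsCMField.complexConj L) v) (cmLocalForm L 2 v))) [ν.IsHaarMeasure] :
    LocallyIntegrable (fun g : ↥(unitaryGroupOfForm (conjLocal L (IsCMField.complexConj L) v) (cmLocalForm L 2 v)) =>
      (((NNReal.sqrt (NNReal.sqrt ((∏ w : PlacesOver L v, normAbs (w.1.adicCompletion L) (((g.val : GL (Fin 2) (UnitaryGroup.LocalRing L v)).val.charpoly.discr) w)) *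
        (∏ w : PlacesOver L v, normAbs (w.1.adicCompletion L) (((g.val : GL (Fin 2) (UnitaryGroup.LocalRing L v)).val.det) w))⁻¹)) : ℝ≥0) : ℝ))⁻¹) ν := by
  obtain ⟨w⟩ := (inferInstance : Nonempty (PlacesOver L v))
  have hw := hns w
  letI : MeasurableSpace ↥(unitaryGroupOfForm (galAdicCompletionMap (L := L) (IsCMField.complexConj L) hw)
      (placeForm (Matrix.of fun i j : Fin 2 => if i.val + j.val + 1 = 2 then (1 : L) else 0) w.1)) := borel _
  haveI : BorelSpace ↥(unitaryGroupOfForm (galAdicCompletionMap (L := L) (IsCMField.complexConj L) hw)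
      (placeForm (Matrix.of fun i j : Fin 2 => if i.val + j.val + 1 = 2 then (1 : L) else 0) w.1)) := ⟨rfl⟩
  let e' : ↥(unitaryGroupOfForm (conjLocal L (IsCMField.complexConj L) v) (cmLocalForm L 2 v)) ≃ₜ*
      ↥(unitaryGroupOfForm (galAdicCompletionMap (L := L) (IsCMField.complexConj L) hw)
        (placeForm (Matrix.of fun i j : Fin 2 => if i.val + j.val + 1 = 2 then (1 : L) else 0) w.1)) :=
    localNonsplitEquiv (IsCMField.complexConj L) (Matrix.of fun i j : Fin 2 => if i.val + j.val + 1 = 2 then (1 : L) else 0) (IsCMField.complexConj_ne_one L) w hw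
  haveI : (ν.map e').IsHaarMeasure := e'.isHaarMeasure_map ν
  exact locallyIntegrable_weylDiscr_inv_two_of_model L v w hw ν (fun g₀ => hcd₂_model L v w hw (ν.map e') g₀)

/-- **(HCD₂) IN ★ D115 CURRENCY — `LocallyIntegrable (fun g => (dgFormula₂ L v g)⁻¹) ν`** for every Haar measure `ν` on `U(Φ₂)(L⁺_v)`, `v` non-split: the `hHCD` antecedent of (ASM₂)
(K2E3-p21 (g8)) token for token (`dgFormula₂_def` is `rfl`). [cite: HarishChandra1970, Part VII §1 Thm. 15] [cite: Rogawski1990, §4.9 p. 54; §12.5 p. 182] -/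
theorem locallyIntegrable_dgFormula₂_inv (hns : ∀ w : PlacesOver L v, IsCMField.complexConj L • w.1 = w.1)
    [MeasurableSpace ↥(unitaryGroupOfForm (conjLocal L (IsCMField.complexConj L) v) (cmLocalForm L 2 v))]
    [BorelSpace ↥(unitaryGroupOfForm (conjLocal L (IsCMField.complexConj L) v) (cmLocalForm L 2 v))]
    (ν : Measure ↥(unitaryGroupOfForm (conjLocal L (IsCMField.complexConj L) v) (cmLocalForm L 2 v))) [ν.IsHaarMeasure] :
    LocallyIntegrable (fun g : ↥(unitaryGroupOfForm (conjLocal L (IsCMField.complexConj L) v) (cmLocalForm L 2 v)) => (dgFormula₂ L v g)⁻¹) ν :=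
  locallyIntegrable_weylDiscr_inv_two L v hns ν

end Head

end Summit.HodgeConjecture.HodgeConjecture.Cruxes.H413.K2E3U11WeylDiscrLocInt

end
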